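import Summits.Ventures.LatticeQCDFlow.Scaling.SwapAcceptanceLadder

/-!
HONEST FRAMING: exact (Metropolis-corrected) sampling algorithms for lattice gauge theory; figures
of merit are autocorrelation/cost numbers at stated couplings and volumes; no continuum-physics
claim.

# SwapAcceptanceKernel — `swapAcc X μ s t` IS THE STATIONARY MEAN ACCEPTANCE OF THE CELL'S EXACT
# REPLICA-EXCHANGE KERNEL: `μ_s ⊗ μ_t = (μ⊗μ).tilted(sX ⊕ tX)` IS INVARIANT UNDER `involMH (trexSwap id) (S₁ ⊕ S₂)`
# (`S₁ = −sX`, `S₂ = −tX`) AND `swapAcc = ∫ involAccept d(μ_s ⊗ μ_t)` (lean-2 GEN-11, ours)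

Venture-side (OURS).  Cell `lqcd-flow` (pub-lqcd), unit `pub-lqcd-lean-2-g11`, 2026-08-23.  Semantic dock of
the swap-acceptance functional of `Scaling/SwapAcceptanceLaw` to the exactness anchor
`Exactness/PTBCSwap.lean` (`ptbcSwap_invariant`: the Metropolis swap kernel `involMH (trexSwap id) (S₁ ⊕ S₂)`
leaves `e^{−S₁(x)−S₂(y)} vol⊗vol` invariant):

* `tilted_eq_smul_withDensity` — `μ.tilted f = (1/∫e^f)·(e^f·μ)` (the tilted measure is the normalised
  Boltzmann measure); **`tilted_prod_tilted`** — `(μ.tilted f) ⊗ (ν.tilted g) = (μ⊗ν).tilted(f ⊕ g)` for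
  measurable `f, g` (s-finite `μ, ν`): the pair of independent replicas is one Boltzmann measure on the product.
* **`swapKernel_invariant`** — for bounded-exponential-family replicas at parameters `s, t` the cell's exact
  swap kernel (energy `S₁ ⊕ S₂`, `S₁ = −s·X`, `S₂ = −t·X`, reference `μ` per replica) leaves the probability
  measure `μ_s ⊗ μ_t` invariant (normalised form of `ptbcSwap_invariant`).
* **`swapAcc_eq_integral_involAccept`** — `swapAcc X μ s t = ∫ involAccept (S₁ ⊕ S₂) (trexSwap id) d(μ_s ⊗ μ_t)`:
  the functional bounded two-sidedly in `SwapAcceptanceLaw` / `SwapAcceptanceLadder` (and docked to the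
  Wilson and defect families in `TrivializingMaps/CouplingLadderLawAnyGroup`, `Scaling/DefectSwapAcceptance`)
  is literally the stationary mean acceptance of that exact kernel.

Literature grade (cell rule): elementary; new typing (bookkeeping).  NOT CLAIMED: anything quantitative beyond
the files cited; mixing / round-trip statements.
-/

noncomputable section

open MeasureTheory ProbabilityTheory Real Set

namespace Summit.Ventures.LatticeQCDFlow.Scaling

/-! ## §1 Tilted measures: normalised Boltzmann form and products -/

section Tilted

variable {α β : Type*} [MeasurableSpace α] [MeasurableSpace β]

/-- **The tilted measure is the normalised Boltzmann measure**: `μ.tilted f = (1/∫e^f dμ) • (μ.withDensity e^f)`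
(when `e^f` is not integrable both sides are `0` by the junk conventions `x/0 = 0`). [folklore] -/
theorem tilted_eq_smul_withDensity (μ : Measure α) (f : α → ℝ) :
    μ.tilted f = ENNReal.ofReal (1 / ∫ x, exp (f x) ∂μ) • μ.withDensity fun x => ENNReal.ofReal (exp (f x)) := by
  have hZ : 0 ≤ 1 / ∫ x, exp (f x) ∂μ :=
    div_nonneg zero_le_one (integral_nonneg fun x => (exp_pos _).le)
  rw [Measure.tilted, ← withDensity_smul' _ _ ENNReal.ofReal_ne_top]
  congr 1
  funext x
  rw [Pi.smul_apply, smul_eq_mul, ← ENNReal.ofReal_mul hZ]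
  congr 1
  ring

variable {μ : Measure α} {ν : Measure β} [SFinite μ] [SFinite ν]

/-- **PRODUCT OF TILTED MEASURES**: `(μ.tilted f) ⊗ (ν.tilted g) = (μ ⊗ ν).tilted (f ⊕ g)` for measurable
`f, g` — two independent replicas form one Boltzmann measure on the product (normalisations multiply by
Fubini). [folklore] -/
theorem tilted_prod_tilted {f : α → ℝ} {g : β → ℝ} (hf : Measurable f) (hg : Measurable g) :
    (μ.tilted f).prod (ν.tilted g) = (μ.prod ν).tilted fun z => f z.1 + g z.2 := by
  have hZf : 0 ≤ ∫ x, exp (f x) ∂μ := integral_nonneg fun x => (exp_pos _).le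
  have hprod : ∫ z, exp (f z.1 + g z.2) ∂(μ.prod ν) = (∫ x, exp (f x) ∂μ) * ∫ y, exp (g y) ∂ν := by
    simp_rw [exp_add]
    exact integral_prod_mul (fun x => exp (f x)) (fun y => exp (g y))
  rw [Measure.tilted, Measure.tilted, Measure.tilted,
    prod_withDensity (hf.exp.div_const _).ennreal_ofReal (hg.exp.div_const _).ennreal_ofReal]
  congr 1
  funext z
  rw [← ENNReal.ofReal_mul (div_nonneg (exp_pos _).le hZf), hprod, div_mul_div_comm, ← exp_add]

end Tilted

/-! ## §2 The exact swap kernel of the cell and the functional `swapAcc` -/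

section Swap

variable {Ω : Type*} [MeasurableSpace Ω] {μ : Measure Ω} [IsProbabilityMeasure μ] {X : Ω → ℝ}

/-- `μ_s ⊗ μ_t = (μ ⊗ μ).tilted (z ↦ sX(z.1) + tX(z.2))`. [folklore] -/
theorem tilted_prod_tilted_mul (hXm : Measurable X) (s t : ℝ) :
    (μ.tilted fun x => s * X x).prod (μ.tilted fun x => t * X x) =
      (μ.prod μ).tilted fun z => s * X z.1 + t * X z.2 :=
  tilted_prod_tilted (measurable_const.mul hXm) (measurable_const.mul hXm)

/-- **INVARIANCE OF THE PAIR MEASURE UNDER THE CELL'S EXACT SWAP KERNEL**: the Metropolis replica-exchange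
kernel `involMH (trexSwap id) (S₁ ⊕ S₂)` of `Exactness/PTBCSwap.lean` with `S₁ = −s·X`, `S₂ = −t·X`
(reference measure `μ` per replica) leaves `μ_s ⊗ μ_t` invariant. [ours] -/
theorem swapKernel_invariant (hXm : Measurable X) (s t : ℝ) :
    Kernel.Invariant
      (Exactness.involMH (Exactness.trexSwap (MeasurableEquiv.refl Ω)) (Exactness.measurable_trexSwap _)
        fun z : Ω × Ω => -(s * X z.1) + -(t * X z.2))
      ((μ.prod μ).tilted fun z => s * X z.1 + t * X z.2) := by
  have h := Exactness.ptbcSwap_invariant (vol := μ) (S₁ := fun x => -(s * X x))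
    (S₂ := fun x => -(t * X x)) (measurable_const.mul hXm).neg (measurable_const.mul hXm).neg
  have hfun : (fun z : Ω × Ω => ENNReal.ofReal (exp (s * X z.1 + t * X z.2))) =
      fun z => ENNReal.ofReal (exp (-(-(s * X z.1) + -(t * X z.2)))) := by
    funext z; congr 1; congr 1; ring
  rw [tilted_eq_smul_withDensity, hfun]
  unfold Kernel.Invariant at h ⊢
  rw [Measure.bind_smul, h]

/-- **`swapAcc` IS THE STATIONARY MEAN ACCEPTANCE OF THAT KERNEL**:
`swapAcc X μ s t = ∫ involAccept (S₁ ⊕ S₂) (trexSwap id) d(μ_s ⊗ μ_t)` with `S₁ = −s·X`, `S₂ = −t·X`. [ours] -/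
theorem swapAcc_eq_integral_involAccept (hXm : Measurable X) (s t : ℝ) :
    swapAcc X μ s t =
      ∫ z, Exactness.involAccept (fun z : Ω × Ω => -(s * X z.1) + -(t * X z.2))
        (Exactness.trexSwap (MeasurableEquiv.refl Ω)) z
        ∂((μ.prod μ).tilted fun z => s * X z.1 + t * X z.2) := by
  unfold swapAcc
  rw [tilted_prod_tilted_mul hXm s t]
  refine integral_congr_ae (ae_of_all _ fun z => ?_)
  obtain ⟨x, y⟩ := z
  exact swapIntegrand_eq_involAccept s t x y

end Swap

end Summit.Ventures.LatticeQCDFlow.Scaling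

end
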